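import Literature.AnabelianGeometry.SemiGraphs.TemperedPiDecompositionConj
import Literature.AnabelianGeometry.SemiGraphs.TemperedPiDecompositionStab
import Literature.AnabelianGeometry.SemiGraphs.TemperedPiSystemSurj
import Literature.AnabelianGeometry.SemiGraphs.TemperedPiPresentationInputs
import HarnessLib

/-!
# Every vertex of a level tree lies under a compatible point sequence ([SemiAnbd] Thm 3.7 (i)/(iii), pp. 40–41)

Mochizuki, *Semi-graphs of anabelioids*, Publ. RIMS **42** (2006) [MochizukiSemiAnbd2006], proof of
Theorem 3.7 (iii) p. 41 ("a compatible system of vertices of `𝒢_{∞,j}`") with Remark 2.2.1 p. 24 ("the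
image of each `Π_v` … is equal to the stabilizer of a compatible system of vertices").
[cite: MochizukiSemiAnbd2006, Thm 3.7(iii) p.41]

PROOF-ONLY file (abc-iut cell, FRONTIER programme REFUTE-F1732, brick R6c, an input of abc-iut-L3-d4's
(hcrit) producer; seat abc-iut-L3-t11 gen 3; no definitions, no named facts).  For a Galois tower
`D : GaloisLevelData 𝒢` (abc-iut-L3-t9): given ONE compatible point sequence `P₀` over the vertex `w`
(abc-iut-L3-t6's `PointSeq`), EVERY vertex `y` of the level-`j` tree `𝔾̃_j` lying over `w` is the level-`j`
vertex of some compatible point sequence over `w` — namely of a translate `g · P₀`, `g ∈ π₁^temp(𝒢)`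
(transitivity of `Aut(𝒢_{∞,j})` on the fibre over `w`, abc-iut-L3-t9's `exists_aut_apply_eq'`, lifted to
`π₁^temp` by the surjectivity of `ρ_j`, `proj_surjective`):

* `PointSeq.exists_smul_vertex_eq` — `∃ g, (P₀.smul g).vertex j = y`;
* `PointSeq.exists_pointSeq_vertex_eq_of_treeProj` — `∃ P : D.PointSeq h𝒢 w, P.vertex j = y`;
* `exists_pointSeq_vertex_eq_galoisLevelData` — the same for the canonical tower `𝒢.galoisLevelData h36` with
  no datum (`GaloisLevelData.nonempty_pointSeq`).

So the local branch-stabiliser lemma `PointSeq.exists_gal_conj_brHom_of_edgeMap_eq`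
(`TemperedPiBranchStabilizerImage.lean`) applies at EVERY tree vertex (the critical vertex `y` of the escape at
the desk countermodel `𝒢_θ` of abc-iut-L3-d1).  Nothing here bears on [IUTchIII] Cor. 3.12; typed ≠ proved.
-/

namespace Literature.AnabelianGeometry.SemiGraphs

namespace ProfiniteSemiGraph

open CategoryTheory Topology

universe u

namespace GaloisLevelData

variable {𝒢 : ProfiniteSemiGraph.{u}} {D : GaloisLevelData 𝒢} {h𝒢 : 𝒢.IsCountable}

namespace PointSeq

variable {w : 𝒢.graph.Vertex} (P₀ : D.PointSeq h𝒢 w)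

/-- **Every level-`j` tree vertex over `w` is the level-`j` vertex of a translate of `P₀`**: for
`y ∈ 𝔾̃_j` over `w` there is `g ∈ π₁^temp(𝒢)` with `(g · P₀).vertex j = y`.
[cite: MochizukiSemiAnbd2006, Thm 3.7(iii) p.41] -/
theorem exists_smul_vertex_eq (j : ℕ) (y : (D.tree j).Vertex) (hy : (D.treeProj j).vertexMap y = w) :
    ∃ g : D.temperedPi h𝒢, (P₀.smul g).vertex j = y := by
  -- a point `t ∈ (𝒢_{∞,j})_w` over `y`
  obtain ⟨t, ht⟩ := exists_point_over (h𝒢 := h𝒢) j y hy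
  -- an automorphism of `𝒢_{∞,j}` moving `P₀.pt j` to `t`, lifted to `π₁^temp`
  obtain ⟨η, hη⟩ := (D.S j).exists_aut_apply_eq' h𝒢 (D.W j) (D.htrans j) (P₀.pt j) t
  obtain ⟨g, hg⟩ := D.proj_surjective h𝒢 j η
  refine ⟨g, ?_⟩
  rw [P₀.smul_vertex, D.treeAct_apply, hg]
  unfold vertex
  rw [D.galTreeAct_vertexMap_mk h𝒢 j η (P₀.pt j)]
  have h2 := ht
  rw [← hη] at h2
  exact h2

include P₀ in
/-- **Every level-`j` tree vertex over `w` lies under a compatible point sequence over `w`** (given one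
point sequence `P₀` over `w`). [cite: MochizukiSemiAnbd2006, Thm 3.7(iii) p.41] -/
theorem exists_pointSeq_vertex_eq_of_treeProj (j : ℕ) (y : (D.tree j).Vertex)
    (hy : (D.treeProj j).vertexMap y = w) : ∃ P : D.PointSeq h𝒢 w, P.vertex j = y := by
  obtain ⟨g, hg⟩ := P₀.exists_smul_vertex_eq j y hy
  exact ⟨P₀.smul g, hg⟩

end PointSeq

end GaloisLevelData

/-- **For the canonical tower `𝒢.galoisLevelData h36`: every vertex of every level tree lies under a
compatible point sequence over its base vertex** (point sequences over every vertex exist,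
`GaloisLevelData.nonempty_pointSeq`). [cite: MochizukiSemiAnbd2006, Thm 3.7(iii) p.41] -/
theorem exists_pointSeq_vertex_eq_galoisLevelData {𝒢 : ProfiniteSemiGraph.{u}} (h36 : 𝒢.Prop36Hypotheses)
    (j : ℕ) (y : ((𝒢.galoisLevelData h36).tree j).Vertex) :
    ∃ P : (𝒢.galoisLevelData h36).PointSeq h36.isCountable (((𝒢.galoisLevelData h36).treeProj j).vertexMap y),
      P.vertex j = y := by
  obtain ⟨P₀⟩ := GaloisLevelData.nonempty_pointSeq h36 (((𝒢.galoisLevelData h36).treeProj j).vertexMap y)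
  exact P₀.exists_pointSeq_vertex_eq_of_treeProj j y rfl

end ProfiniteSemiGraph

end Literature.AnabelianGeometry.SemiGraphs
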